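import Literature.Analysis.Complex.HolomorphicParametricIntegral
import Literature.Analysis.Complex.OsgoodProofs
import Mathlib.Analysis.Complex.CauchyIntegral
import HarnessLib

/-!
# Osgood's lemma: continuous and separately holomorphic functions are jointly holomorphic

Analysis/Complex support file (everything proved; theorems only, no named facts). The classical
lemma of W. F. Osgood (Math. Ann. 52 (1899); Hörmander, *An Introduction to Complex Analysis in
Several Variables*, proof of Thm. 2.2.1 / Lemma 2.2.?; Gunning–Rossi, Thm. I.A.2): a function
`f : ℂⁿ → F` (`F` a complex Banach space) which is **continuous** on an open set `U` and
**holomorphic in each coordinate separately** (for every `z ∈ U` and every `i`, the slice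
`t ↦ f (z with zᵢ := t)` is complex differentiable at `zᵢ`) is complex (Fréchet-)differentiable
on `U` (`Literature.Analysis.Complex.SCV.differentiableOn_of_continuousOn_of_separately`), hence
analytic there (`….analyticOnNhd_of_continuousOn_of_separately`, with the tree's Osgood lemma
"holomorphic ⇒ analytic", `Literature.Analysis.Complex.SCV.analyticOnNhd_of_differentiableOn`).
(Without the continuity hypothesis this is Hartogs' much deeper theorem, not treated here.)

## Proof

The two-block case (`differentiableOn_prod_of_separately`): `g : ℂ × P → F` continuous on an open
`U`, holomorphic in the first variable at every point and holomorphic in the block `P` (a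
finite-dimensional complex normed space) on every slice. Near `(t₀, p₀)` Cauchy's formula in the
first variable,

  `g(t, p) = (2πi)⁻¹ ∮_{|s - t₀| = ρ} (s − t)⁻¹ g(s, p) ds`,   `|t − t₀| < ρ/2`, `‖p − p₀‖ < ρ`,

(Mathlib's `Complex.circleIntegral_sub_inv_smul_of_differentiable_on_off_countable`) writes `g`
as a parameter integral whose integrand is, for each `s` on the circle, jointly holomorphic in
`(t, p)` (a holomorphic scalar function of `t` times a holomorphic function of `p`) and bounded by
`2 sup |g|` over the compact set `sphere × closedBall ⊆ U`; the tree's dominated holomorphic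
parameter integral (`Literature.Analysis.Complex.differentiableOn_integral_of_dominated`, which
needs no hypothesis on derivatives) makes it holomorphic in `(t, p)`. The `n`-variable statement
follows by induction on `n`, splitting `ℂ^{n+1} = ℂ × ℂⁿ` with `Fin.cons` (the slices in the last
`n` variables are continuous and separately holomorphic, so holomorphic by induction).

## References

* W. F. Osgood, *Note über analytische Functionen mehrerer Veränderlichen*, Math. Ann. 52 (1899)
  462–464.
* L. Hörmander, *An Introduction to Complex Analysis in Several Variables* (1973), §2.2.
  [HormanderSCV1973]
* R. C. Gunning, H. Rossi, *Analytic Functions of Several Complex Variables* (1965), Ch. I §A,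
  Thm. 2 (Osgood's lemma).

## Mathlib

`Complex.circleIntegral_sub_inv_smul_of_differentiable_on_off_countable` (Cauchy's integral
formula), `circleIntegral_def_Icc`, `ContinuousLinearEquiv.comp_right_differentiableOn_iff`,
`Fin.consEquivL` (the splitting `ℂ × ℂⁿ ≃L ℂ^{n+1}`), `Fin.update_cons_zero`, `Fin.cons_update`. Mathlib has no statement about separately
holomorphic functions (searched `separately`, `Hartogs`, `Osgood`); the tree's `Osgood.lean` /
`OsgoodProofs.lean` are the "holomorphic ⇒ analytic" half.
-/

noncomputable section

open MeasureTheory Metric Set Filter Complex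
open _root_.Topology

namespace Literature.Analysis.Complex.SCV

variable {P : Type*} [NormedAddCommGroup P] [NormedSpace ℂ P] [FiniteDimensional ℂ P]
variable {F : Type*} [NormedAddCommGroup F] [NormedSpace ℂ F] [CompleteSpace F]

/-! ### The two-block case -/

/-- Distance from a point of the disc `|t - t₀| < ρ/2` to the circle `|s - t₀| = ρ`. [folklore] -/
theorem norm_circleMap_sub_ge {t₀ t : ℂ} {ρ : ℝ} (hρ : 0 ≤ ρ) (ht : t ∈ ball t₀ (ρ / 2))
    (θ : ℝ) : ρ / 2 ≤ ‖circleMap t₀ ρ θ - t‖ := by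
  have h1 : ‖circleMap t₀ ρ θ - t₀‖ = ρ := by
    rw [circleMap_sub_center, norm_circleMap_zero, abs_of_nonneg hρ]
  have h2 : ‖t - t₀‖ < ρ / 2 := by rwa [mem_ball, dist_eq_norm] at ht
  have h3 : ‖circleMap t₀ ρ θ - t₀‖ ≤ ‖circleMap t₀ ρ θ - t‖ + ‖t - t₀‖ := by
    simpa using norm_sub_le_norm_sub_add_norm_sub (circleMap t₀ ρ θ) t t₀
  linarith

/-- **Osgood's lemma, two-block form.** Let `g : ℂ × P → F` be continuous on an open set `U`,
complex differentiable in the first variable at every point of `U`, and complex differentiable in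
the block `P` on every slice `{p | (t, p) ∈ U}`. Then `g` is complex differentiable on `U`
(Cauchy's formula in the first variable + holomorphic dependence of parameter integrals). [folklore] -/
theorem differentiableOn_prod_of_separately {g : ℂ × P → F} {U : Set (ℂ × P)} (hU : IsOpen U)
    (hc : ContinuousOn g U) (ht : ∀ q ∈ U, DifferentiableAt ℂ (fun t => g (t, q.2)) q.1)
    (hp : ∀ t : ℂ, DifferentiableOn ℂ (fun p => g (t, p)) {p | (t, p) ∈ U}) :
    DifferentiableOn ℂ g U := by
  intro q₀ hq₀
  obtain ⟨ε, hε, hεU⟩ := Metric.isOpen_iff.1 hU q₀ hq₀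
  set ρ : ℝ := ε / 2 with hρdef
  have hρ : 0 < ρ := by positivity
  -- the closed bidisc of radius ρ lies in U
  have hsub : closedBall q₀.1 ρ ×ˢ closedBall q₀.2 ρ ⊆ U := by
    intro x hx
    apply hεU
    rw [mem_ball, Prod.dist_eq]
    have h1 : dist x.1 q₀.1 ≤ ρ := mem_closedBall.1 hx.1
    have h2 : dist x.2 q₀.2 ≤ ρ := mem_closedBall.1 hx.2
    calc max (dist x.1 q₀.1) (dist x.2 q₀.2) ≤ ρ := max_le h1 h2
      _ < ε := by rw [hρdef]; linarith
  -- the neighbourhood on which we prove differentiability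
  set V : Set (ℂ × P) := ball q₀.1 (ρ / 2) ×ˢ ball q₀.2 ρ with hV
  have hVo : IsOpen V := isOpen_ball.prod isOpen_ball
  have hq₀V : q₀ ∈ V := ⟨mem_ball_self (by positivity), mem_ball_self hρ⟩
  suffices hdiff : DifferentiableOn ℂ g V from
    (hdiff.differentiableAt (hVo.mem_nhds hq₀V)).differentiableWithinAt
  -- a bound for g on the compact set sphere × closedBall ⊆ U
  have hKc : IsCompact (sphere q₀.1 ρ ×ˢ closedBall q₀.2 ρ) :=
    (isCompact_sphere _ _).prod (isCompact_closedBall _ _)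
  have hKU : sphere q₀.1 ρ ×ˢ closedBall q₀.2 ρ ⊆ U :=
    (Set.prod_mono sphere_subset_closedBall Subset.rfl).trans hsub
  obtain ⟨M₀, hM₀⟩ := hKc.exists_bound_of_continuousOn (hc.mono hKU)
  set M := max M₀ 0 with hM
  have hMg : ∀ x ∈ sphere q₀.1 ρ ×ˢ closedBall q₀.2 ρ, ‖g x‖ ≤ M := fun x hx =>
    (hM₀ x hx).trans (le_max_left _ _)
  have hM0 : 0 ≤ M := le_max_right _ _
  -- the Cauchy integrand as a function of the parameter q = (t, p) and the angle θ
  set K : ℂ × P → ℝ → F := fun q θ =>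
    deriv (circleMap q₀.1 ρ) θ • ((circleMap q₀.1 ρ θ - q.1)⁻¹ • g (circleMap q₀.1 ρ θ, q.2))
    with hK
  -- points used below lie in U
  have hmemU : ∀ q ∈ V, ∀ θ : ℝ, (circleMap q₀.1 ρ θ, q.2) ∈ U := fun q hq θ =>
    hKU ⟨circleMap_mem_sphere _ hρ.le _, ball_subset_closedBall hq.2⟩
  have hne : ∀ q ∈ V, ∀ θ : ℝ, circleMap q₀.1 ρ θ - q.1 ≠ 0 := by
    intro q hq θ h
    have := norm_circleMap_sub_ge hρ.le hq.1 θ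
    rw [h, norm_zero] at this
    linarith
  -- (1) Cauchy's formula: ∫ K q = 2πi • g q on V
  have hCauchy : ∀ q ∈ V, ∫ θ in Icc 0 (2 * Real.pi), K q θ = (2 * Real.pi * I : ℂ) • g q := by
    intro q hq
    have hcirc := Complex.circleIntegral_sub_inv_smul_of_differentiable_on_off_countable
      (f := fun s => g (s, q.2)) countable_empty (ball_subset_ball (by linarith) hq.1 :
        q.1 ∈ ball q₀.1 ρ) ?_ ?_
    · rw [circleIntegral_def_Icc] at hcirc
      simpa [hK] using hcirc
    · refine hc.comp (by fun_prop) fun s hs => hsub ⟨hs, ball_subset_closedBall hq.2⟩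
    · rintro x ⟨hx, -⟩
      exact ht (x, q.2) (hsub ⟨ball_subset_closedBall hx, ball_subset_closedBall hq.2⟩)
  -- (2) the parameter integral is holomorphic on V
  have hInt : DifferentiableOn ℂ (fun q => ∫ θ in Icc 0 (2 * Real.pi), K q θ) V := by
    refine differentiableOn_integral_of_dominated (μ := volume.restrict (Icc 0 (2 * Real.pi)))
      (fun q hq => ?_) (Eventually.of_forall fun θ => ?_) (fun x hx => ?_)
    · -- measurability: the integrand is continuous in θ
      refine Continuous.aestronglyMeasurable ?_
      have h1 : Continuous fun θ : ℝ => deriv (circleMap q₀.1 ρ) θ := by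
        simp only [deriv_circleMap]; fun_prop
      have h2 : Continuous fun θ : ℝ => (circleMap q₀.1 ρ θ - q.1)⁻¹ :=
        ((continuous_circleMap _ _).sub continuous_const).inv₀ (hne q hq)
      have h3 : Continuous fun θ : ℝ => g (circleMap q₀.1 ρ θ, q.2) :=
        hc.comp_continuous (by fun_prop) (hmemU q hq)
      exact h1.smul (h2.smul h3)
    · -- holomorphy in q for fixed θ
      have h1 : DifferentiableOn ℂ (fun q : ℂ × P => (circleMap q₀.1 ρ θ - q.1)⁻¹) V :=
        ((differentiableOn_const _).sub differentiableOn_fst).inv fun q hq => hne q hq θ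
      have h2 : DifferentiableOn ℂ (fun q : ℂ × P => g (circleMap q₀.1 ρ θ, q.2)) V := by
        have h := hp (circleMap q₀.1 ρ θ)
        exact h.comp differentiableOn_snd fun q hq => hmemU q hq θ
      exact (h1.smul h2).const_smul _
    · -- local (here: global) majorant 2M
      obtain ⟨R, hR, hRV⟩ := Metric.isOpen_iff.1 hVo x hx
      refine ⟨R, hR, hRV, fun _ => ρ * (ρ / 2)⁻¹ * M, integrable_const _,
        Eventually.of_forall fun θ q hq => ?_⟩
      have hqV := hRV hq
      rw [hK]
      simp only [norm_smul]
      have e1 : ‖deriv (circleMap q₀.1 ρ) θ‖ = ρ := by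
        rw [deriv_circleMap, norm_mul, norm_circleMap_zero, Complex.norm_I, mul_one,
          abs_of_nonneg hρ.le]
      have e2 : ‖(circleMap q₀.1 ρ θ - q.1)⁻¹‖ ≤ (ρ / 2)⁻¹ := by
        rw [norm_inv]
        exact inv_anti₀ (by positivity) (norm_circleMap_sub_ge hρ.le hqV.1 θ)
      have e3 : ‖g (circleMap q₀.1 ρ θ, q.2)‖ ≤ M :=
        hMg _ ⟨circleMap_mem_sphere _ hρ.le _, ball_subset_closedBall hqV.2⟩
      rw [e1]
      have : 0 ≤ (ρ / 2)⁻¹ := by positivity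
      calc ρ * (‖(circleMap q₀.1 ρ θ - q.1)⁻¹‖ * ‖g (circleMap q₀.1 ρ θ, q.2)‖)
          ≤ ρ * ((ρ / 2)⁻¹ * M) := by gcongr
        _ = ρ * (ρ / 2)⁻¹ * M := by ring
  -- (3) conclude
  have h2pi : (2 * Real.pi * I : ℂ) ≠ 0 := by simp [Real.pi_ne_zero, Complex.I_ne_zero]
  refine ((hInt.const_smul (2 * Real.pi * I : ℂ)⁻¹).congr fun q hq => ?_)
  simp only [Pi.smul_apply]
  rw [hCauchy q hq, smul_smul, inv_mul_cancel₀ h2pi, one_smul]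

/-! ### The `n`-variable statement -/

/-- **Osgood's lemma** (Osgood 1899; Gunning–Rossi Thm. I.A.2; Hörmander §2.2): a function on an
open subset `U ⊆ ℂⁿ` with values in a complex Banach space which is continuous on `U` and complex
differentiable in each coordinate separately at every point of `U` is complex
(Fréchet-)differentiable on `U`. [cite: HormanderSCV1973, §2.2 (Osgood's lemma)] -/
theorem differentiableOn_of_continuousOn_of_separately :
    ∀ {n : ℕ} {f : (Fin n → ℂ) → F} {U : Set (Fin n → ℂ)}, IsOpen U → ContinuousOn f U →
      (∀ z ∈ U, ∀ i : Fin n, DifferentiableAt ℂ (fun t : ℂ => f (Function.update z i t)) (z i)) →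
      DifferentiableOn ℂ f U
  | 0, f, U, _, _, _ => by
    intro z hz
    have hconst : f = fun _ => f z := funext fun w => congrArg f (Subsingleton.elim w z)
    rw [hconst]
    exact (differentiableOn_const _) z hz
  | n + 1, f, U, hU, hc, hs => by
    set e : (ℂ × (Fin n → ℂ)) ≃L[ℂ] (Fin (n + 1) → ℂ) :=
      Fin.consEquivL ℂ (fun _ : Fin (n + 1) => ℂ) with he
    have hea : ∀ q : ℂ × (Fin n → ℂ), e q = Fin.cons q.1 q.2 := fun q => rfl
    -- transfer to ℂ × ℂⁿ
    rw [← e.comp_right_differentiableOn_iff]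
    have hU' : IsOpen (e ⁻¹' U) := hU.preimage e.continuous
    refine differentiableOn_prod_of_separately hU' (hc.comp e.continuous.continuousOn
      fun q hq => hq) (fun q hq => ?_) (fun t => ?_)
    · -- the first variable
      have hz : (Fin.cons q.1 q.2 : Fin (n + 1) → ℂ) ∈ U := hq
      have h := hs _ hz 0
      simp only [Fin.cons_zero] at h
      have hfun : (fun t : ℂ => (f ∘ e) (t, q.2)) =
          fun t => f (Function.update (Fin.cons q.1 q.2 : Fin (n + 1) → ℂ) 0 t) := by
        funext t
        rw [Function.comp_apply, hea, Fin.update_cons_zero]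
      rw [hfun]
      exact h
    · -- the block of the last n variables: induction hypothesis on the slice
      have hslice : IsOpen {v : Fin n → ℂ | (Fin.cons t v : Fin (n + 1) → ℂ) ∈ U} :=
        hU.preimage (by fun_prop)
      have hcs : ContinuousOn (fun v : Fin n → ℂ => f (Fin.cons t v))
          {v : Fin n → ℂ | (Fin.cons t v : Fin (n + 1) → ℂ) ∈ U} :=
        hc.comp (by fun_prop) fun v hv => hv
      have hsep : ∀ v ∈ {v : Fin n → ℂ | (Fin.cons t v : Fin (n + 1) → ℂ) ∈ U}, ∀ i : Fin n,
          DifferentiableAt ℂ (fun s : ℂ => f (Fin.cons t (Function.update v i s))) (v i) := by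
        intro v hv i
        have h := hs _ hv i.succ
        simp only [Fin.cons_succ] at h
        have hfun : (fun s : ℂ => f (Fin.cons t (Function.update v i s))) =
            fun s => f (Function.update (Fin.cons t v : Fin (n + 1) → ℂ) i.succ s) := by
          funext s; rw [Fin.cons_update]
        rw [hfun]; exact h
      have ih := differentiableOn_of_continuousOn_of_separately hslice hcs hsep
      show DifferentiableOn ℂ (fun p => f (e (t, p))) {p | e (t, p) ∈ U}
      simp only [hea]
      exact ih

/-- **Osgood's lemma, analytic form**: continuous and separately holomorphic on an open
`U ⊆ ℂⁿ` implies analytic on `U`. [cite: HormanderSCV1973, §2.2 (Osgood's lemma)] -/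
theorem analyticOnNhd_of_continuousOn_of_separately {n : ℕ} {f : (Fin n → ℂ) → F}
    {U : Set (Fin n → ℂ)} (hU : IsOpen U) (hc : ContinuousOn f U)
    (hs : ∀ z ∈ U, ∀ i : Fin n, DifferentiableAt ℂ (fun t : ℂ => f (Function.update z i t)) (z i)) :
    AnalyticOnNhd ℂ f U :=
  analyticOnNhd_of_differentiableOn (differentiableOn_of_continuousOn_of_separately hU hc hs) hU

/-- **Osgood's lemma with slice-wise hypotheses**: if `f` is continuous on an open `U ⊆ ℂⁿ` and,
for every `z ∈ U` and `i`, the slice `t ↦ f (z with zᵢ := t)` is complex differentiable on the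
open set of `t` with `(z with zᵢ := t) ∈ U`, then `f` is complex differentiable on `U`. [cite: HormanderSCV1973, §2.2 (Osgood's lemma)] -/
theorem differentiableOn_of_continuousOn_of_differentiableOn_update {n : ℕ} {f : (Fin n → ℂ) → F}
    {U : Set (Fin n → ℂ)} (hU : IsOpen U) (hc : ContinuousOn f U)
    (hs : ∀ z ∈ U, ∀ i : Fin n, DifferentiableOn ℂ (fun t : ℂ => f (Function.update z i t))
      {t | Function.update z i t ∈ U}) :
    DifferentiableOn ℂ f U := by
  refine differentiableOn_of_continuousOn_of_separately hU hc fun z hz i => ?_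
  have ho : IsOpen {t : ℂ | Function.update z i t ∈ U} := hU.preimage (by fun_prop)
  have hmem : z i ∈ {t : ℂ | Function.update z i t ∈ U} := by simpa using hz
  exact (hs z hz i).differentiableAt (ho.mem_nhds hmem)

end Literature.Analysis.Complex.SCV
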